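import Summits.QuantumFields.QCD.Theses.EulerDescent
import Summits.QuantumFields.QCD.Theses.SpectralDefectExtinction
import Summits.QuantumFields.QCD.Theorems.RobustYangMillsHandover.Negative.SchemeAsymptotics

/-!
# Crux `SpectralDefectExtinction.ChiralDescent` (stmt-QuantumFields-17527) BY NAME from route EulerDescent's three
# ∀-items plus the two residuals of line `gap-upset-recut`: the wall no-go W and `CornerPin` (lead a1, cycle 1)

`chiralDescent_of_eulerDescent_of_wallNoGo_of_cornerPin`: IF
* `Theses.EulerDescent.RayDescent` (stmt-16900), `Theses.EulerDescent.ChiralCornerSoftness` (stmt-16902) and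
  `Theses.EulerDescent.RetypedContinuumComplement` (stmt-16903) hold (open items of route EulerDescent, hypotheses),
* W = the registered stub `stub_wallNoGo` of `Cruxes/ChiralDescent/Lines/gap_upset_recut.lean` holds (verbatim, as a
  hypothesis: a mass-scaling regularisation with `lim inf m_crit ≤ −1` carries the body above no offset), and
* `CornerPin` holds (verbatim the hypothesis `hPin` of `stub_gapUpsetNoStart_of_cornerPin`: an interior mass-scaling
  regularisation carrying the body above some offset admits an eventual intrinsic corner `mc` — the IsLUB corner of
  `RayDescent` — and a convergent renormalised offset `(m_crit − mc)·Z_m/a → μ₀`),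
THEN `ChiralDescent`.  Proof: the threshold regularisation `reg` of the crux's antecedent is at the wall (W: contradiction)
or interior; then re-zero it at its corner (`reg₀.m_crit := m_crit − a μ₀/Z_m`, `reg₀.scheme m = reg.scheme (m − μ₀)`):
`reg₀` is pinned, mass-scaling, asymptotically scaling (read off one body tuple), eventually on the physical branch, and
carries the HEAVY body above `max (M₁ + μ₀) 0 + 1` — i.e. `reg₀` is an honest heavy anchor in the sense of
`Theses.EulerDescent.HonestHeavyAnchor` for this `N_f` — so EulerDescent's own assembly (`Theses.EulerDescent.closes`,
re-run per flavour number) gives `QCDOf N_f`: lattice gaps at every positive tuple by ray descent from the heavy body,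
the full body by 16903, chirality by 16902.

CONSEQUENCE FOR THE LINE (information for the planners of 17527 and of route EulerDescent): granted 16900 ∧ 16902 ∧ 16903,
the crux needs NEITHER Q1 (⇐ item 18328) NOR the two-up-set order theory: its residual new content is exactly
(W, CornerPin) — "a threshold regularisation is not at the wall, and an interior body-carrying regularisation sits at a
convergent renormalised offset from the intrinsic Wilson corner" (the `LocateChiralPoint` step of the route's TWO-LAYER
PLAN, typed).  Conversely the crux's antecedent `Threshold N_f` plus interiority plus `CornerPin` is precisely what
upgrades a threshold regularisation to EulerDescent's missing ∃-item `HonestHeavyAnchor` at that `N_f`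
(`honestHeavyAnchorAt_of_threshold_of_cornerPin`).  Nothing here proves physics; 16900/16902/16903, W (exact wall) and
CornerPin are open-problem grade.  Pure bookkeeping over `QCDOS.lean`; standard axioms.
-/

namespace Summit.QuantumFields.QCD.Cruxes.ChiralDescent.GapUpsetRecut

open Filter Topology
open Literature.MathematicalPhysics.QuantumFieldTheory
open Summit.QuantumFields.QCD.Theorems.RobustYangMillsHandover.Negative (tendsto_massIncrement_zero)

variable {Nf : ℕ}

/-- Re-zeroing at the corner, scheme level (same statement as `cornerShift_scheme_eq` of the Q2 file; private copy so
that this file elaborates on its own). [folklore] -/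
private theorem cornerShift_scheme_eq' (reg : QCDRegularisation Nf) (μ₀ : ℝ) (m : Fin Nf → ℝ)
    (z shift : QCDField Nf → ℕ → ℝ) :
    ({ reg with mcrit := fun k => reg.mcrit k + reg.a k * (-μ₀) / reg.Zm k } : QCDRegularisation Nf).scheme m z shift
      = reg.scheme (fun f => m f - μ₀) z shift := by
  simp only [QCDRegularisation.scheme, QCDScheme.mk.injEq, true_and, and_true]
  funext f k
  ring

/-- **Threshold + interiority + CornerPin ⇒ an honest heavy anchor at this `N_f`.**  For `N_f ∈ {2,3}`, an interior
mass-scaling regularisation `reg` carrying the body above `M₁`, an eventual intrinsic corner `mc` and a convergent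
offset `(m_crit − mc)·Z_m/a → μ₀`: the re-zeroed regularisation `reg₀` (`m_crit − a μ₀/Z_m`) together with `mc` and
`M_h := max (M₁ + μ₀) 0 + 1` satisfies every clause of `Theses.EulerDescent.HonestHeavyAnchor` at this `N_f` (corner,
pin `→ 0`, mass scaling, asymptotic scaling, physical branch, `0 < M_h`, heavy body). [folklore] -/
theorem honestHeavyAnchorAt_of_threshold_of_cornerPin (hNf : Nf = 2 ∨ Nf = 3) (reg : QCDRegularisation Nf)
    (hMS : reg.HasMassScaling) (hint : ∃ c : ℝ, -1 < c ∧ ∀ᶠ k in atTop, c ≤ reg.mcrit k) {M₁ : ℝ}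
    (hbody : ∀ m : Fin Nf → ℝ, (∀ f, M₁ < m f) →
      ∃ (z shift : QCDField Nf → ℕ → ℝ) (T : OSData (QCDField Nf) 4),
        IsQCDAlong (reg.scheme m z shift) T ∧ T.IsNontrivial QCDField.glue ∧ T.IsNonGaussian QCDField.glue ∧
          (∀ f g : Fin Nf, f ≠ g → T.IsNontrivial (QCDField.pseudoRe f g)) ∧
            ∃ Δ > 0, T.HasMassGap Δ ∧ (reg.scheme m z shift).HasLatticeMassGap Δ)
    {mc : ℕ → ℝ} {μ₀ : ℝ}
    (hcorner : ∀ᶠ k in atTop, IsLUB {ν : ℝ | ¬ (∀ (R R' : ℕ) (A : QCDLatticeObservable Nf R)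
      (B : QCDLatticeObservable Nf R'), ∃ (C δ : ℝ) (S₀ : ℕ), 0 < δ ∧ ∀ S : ℕ, S₀ ≤ S → ∀ n : ℕ, n ≤ S →
        ‖qcdLatticeConnectedCorr (reg.β k) (2 * S + 1) (fun _ : Fin Nf => ν) A B n‖ ≤ C * Real.exp (-(δ * n)))}
      (mc k))
    (hpin : Tendsto (fun k => (reg.mcrit k - mc k) * reg.Zm k / reg.a k) atTop (𝓝 μ₀)) :
    ∃ (reg₀ : QCDRegularisation Nf) (Mh : ℝ),
      (∀ (m : Fin Nf → ℝ) (z shift : QCDField Nf → ℕ → ℝ),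
        reg₀.scheme m z shift = reg.scheme (fun f => m f - μ₀) z shift) ∧
      (∀ᶠ k in atTop, IsLUB {ν : ℝ | ¬ (∀ (R R' : ℕ) (A : QCDLatticeObservable Nf R)
        (B : QCDLatticeObservable Nf R'), ∃ (C δ : ℝ) (S₀ : ℕ), 0 < δ ∧ ∀ S : ℕ, S₀ ≤ S → ∀ n : ℕ, n ≤ S →
          ‖qcdLatticeConnectedCorr (reg₀.β k) (2 * S + 1) (fun _ : Fin Nf => ν) A B n‖ ≤ C * Real.exp (-(δ * n)))}
        (mc k)) ∧
      Tendsto (fun k => (reg₀.mcrit k - mc k) * reg₀.Zm k / reg₀.a k) atTop (𝓝 0) ∧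
      reg₀.HasMassScaling ∧ (reg₀.scheme 0 0 0).HasAsymptoticScaling ∧ (∀ᶠ k in atTop, (-1 : ℝ) < reg₀.mcrit k) ∧
      0 < Mh ∧
      ∀ m : Fin Nf → ℝ, (∀ f, Mh ≤ m f) →
        ∃ (z shift : QCDField Nf → ℕ → ℝ) (T : OSData (QCDField Nf) 4),
          IsQCDAlong (reg₀.scheme m z shift) T ∧ T.IsNontrivial QCDField.glue ∧ T.IsNonGaussian QCDField.glue ∧
            (∀ f g : Fin Nf, f ≠ g → T.IsNontrivial (QCDField.pseudoRe f g)) ∧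
              ∃ Δ > 0, T.HasMassGap Δ ∧ (reg₀.scheme m z shift).HasLatticeMassGap Δ := by
  have hNf16 : Nf ≤ 16 := by rcases hNf with rfl | rfl <;> norm_num
  set reg₀ : QCDRegularisation Nf :=
    { reg with mcrit := fun k => reg.mcrit k + reg.a k * (-μ₀) / reg.Zm k } with hreg₀
  have hs : ∀ (m : Fin Nf → ℝ) (z shift : QCDField Nf → ℕ → ℝ),
      reg₀.scheme m z shift = reg.scheme (fun f => m f - μ₀) z shift :=
    fun m z shift => cornerShift_scheme_eq' reg μ₀ m z shift
  refine ⟨reg₀, max (M₁ + μ₀) 0 + 1, hs, hcorner, ?_, hMS, ?_, ?_, by positivity, ?_⟩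
  · -- the pin of reg₀ tends to 0
    have h1 : Tendsto (fun k => (reg.mcrit k - mc k) * reg.Zm k / reg.a k - μ₀) atTop (𝓝 (μ₀ - μ₀)) :=
      hpin.sub_const μ₀
    rw [sub_self] at h1
    refine h1.congr' (Eventually.of_forall fun k => ?_)
    have ha : reg.a k ≠ 0 := (reg.a_pos k).ne'
    have hZ : reg.Zm k ≠ 0 := (reg.Zm_pos k).ne'
    change (reg.mcrit k - mc k) * reg.Zm k / reg.a k - μ₀ =
      ((reg.mcrit k + reg.a k * (-μ₀) / reg.Zm k) - mc k) * reg.Zm k / reg.a k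
    field_simp
    ring
  · -- asymptotic scaling, read off the body tuple M₁ + 1
    obtain ⟨z₁, s₁, T₁, hQ₁, -⟩ := hbody (fun _ => M₁ + 1) (fun _ => by linarith)
    obtain ⟨hAS, -⟩ := hQ₁
    exact hAS
  · -- physical branch: interiority plus a vanishing increment
    obtain ⟨c, hc, hev⟩ := hint
    have h0 := tendsto_massIncrement_zero hNf16 reg hMS (-μ₀)
    have hneg : -((c + 1) / 2) < (0 : ℝ) := by linarith
    filter_upwards [hev, (tendsto_order.mp h0).1 (-((c + 1) / 2)) hneg] with k hk hk'
    change (-1 : ℝ) < reg.mcrit k + reg.a k * (-μ₀) / reg.Zm k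
    linarith
  · -- heavy body of reg₀ above max (M₁ + μ₀) 0 + 1
    intro m hm
    obtain ⟨z, s, T, hT⟩ := hbody (fun f => m f - μ₀) (fun f => by
      have h1 := hm f
      have h2 : M₁ + μ₀ ≤ max (M₁ + μ₀) 0 := le_max_left _ _
      linarith)
    exact ⟨z, s, T, by rw [hs]; exact hT⟩

/-- **`QCDOf N_f` from an honest heavy anchor at `N_f` and the three ∀-items of route EulerDescent** — the per-flavour
content of `Theses.EulerDescent.closes` (same arithmetic: `l := 1 + Σ_f M_h/m_f` makes `l·m` heavy, ray descent gives
a lattice gap `Δ/(2l)` at `m`, 16903 the full body, 16902 chirality). [folklore] -/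
theorem qcdOf_of_anchorAt_of_eulerDescent (h16900 : Theses.EulerDescent.RayDescent)
    (h16902 : Theses.EulerDescent.ChiralCornerSoftness) (h16903 : Theses.EulerDescent.RetypedContinuumComplement)
    (hNf : Nf = 2 ∨ Nf = 3) (reg : QCDRegularisation Nf) (mc : ℕ → ℝ) (Mh : ℝ)
    (hcorner : ∀ᶠ k in atTop, IsLUB {ν : ℝ | ¬ (∀ (R R' : ℕ) (A : QCDLatticeObservable Nf R)
      (B : QCDLatticeObservable Nf R'), ∃ (C δ : ℝ) (S₀ : ℕ), 0 < δ ∧ ∀ S : ℕ, S₀ ≤ S → ∀ n : ℕ, n ≤ S →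
        ‖qcdLatticeConnectedCorr (reg.β k) (2 * S + 1) (fun _ : Fin Nf => ν) A B n‖ ≤ C * Real.exp (-(δ * n)))}
      (mc k))
    (hpin : Tendsto (fun k => (reg.mcrit k - mc k) * reg.Zm k / reg.a k) atTop (𝓝 0))
    (hms : reg.HasMassScaling) (haf : (reg.scheme 0 0 0).HasAsymptoticScaling)
    (hbranch : ∀ᶠ k in atTop, (-1 : ℝ) < reg.mcrit k) (hMh : 0 < Mh)
    (hbody : ∀ m : Fin Nf → ℝ, (∀ f, Mh ≤ m f) →
      ∃ (z shift : QCDField Nf → ℕ → ℝ) (T : OSData (QCDField Nf) 4),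
        IsQCDAlong (reg.scheme m z shift) T ∧ T.IsNontrivial QCDField.glue ∧ T.IsNonGaussian QCDField.glue ∧
          (∀ f g : Fin Nf, f ≠ g → T.IsNontrivial (QCDField.pseudoRe f g)) ∧
            ∃ Δ > 0, T.HasMassGap Δ ∧ (reg.scheme m z shift).HasLatticeMassGap Δ) :
    QCDOf Nf := by
  have hgap : ∀ m : Fin Nf → ℝ, (∀ f, 0 < m f) → ∃ Δ > 0, (reg.scheme m 0 0).HasLatticeMassGap Δ := by
    intro m hm
    set l : ℝ := 1 + ∑ f, Mh / m f with hl
    have hterm : ∀ f, 0 ≤ Mh / m f := fun f => div_nonneg hMh.le (hm f).le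
    have hsum : 0 ≤ ∑ f, Mh / m f := Finset.sum_nonneg fun f _ => hterm f
    have hl1 : 1 ≤ l := by rw [hl]; linarith
    have hlpos : 0 < l := lt_of_lt_of_le one_pos hl1
    have hheavy : ∀ f, Mh ≤ l * m f := by
      intro f
      have h1 : Mh / m f ≤ ∑ g, Mh / m g := Finset.single_le_sum (fun g _ => hterm g) (Finset.mem_univ f)
      have h2 : Mh / m f ≤ l := by rw [hl]; linarith
      calc Mh = Mh / m f * m f := by rw [div_mul_cancel₀ _ (hm f).ne']
        _ ≤ l * m f := mul_le_mul_of_nonneg_right h2 (hm f).le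
    obtain ⟨z, shift, T, -, -, -, -, Δ, hΔ, -, hlat⟩ := hbody (fun f => l * m f) hheavy
    have hlat0 : (reg.scheme (fun f => l * m f) 0 0).HasLatticeMassGap Δ := hlat
    refine ⟨Δ / l / 2, by positivity, ?_⟩
    have hlt : Δ / l / 2 < Δ / l := by
      have : 0 < Δ / l := by positivity
      linarith
    exact h16900 Nf reg mc hcorner hpin hms haf hbranch m hm l hl1 Δ hΔ hlat0 (Δ / l / 2) (by positivity) hlt
  have hchi : reg.IsChiralAtZero := h16902 Nf hNf reg mc hcorner hpin hms haf hbranch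
  have hfull := h16903 Nf hNf reg hms haf hbranch ⟨Mh, hMh, hbody⟩ hgap
  exact ⟨reg, hms, hchi, hfull⟩

/-- **The crux BY NAME from 16900 ∧ 16902 ∧ 16903 ∧ W ∧ CornerPin.**  For the threshold regularisation of the antecedent:
wall ⇒ contradiction by W; interior ⇒ `CornerPin` locates the corner, `honestHeavyAnchorAt_of_threshold_of_cornerPin`
re-zeroes there, `qcdOf_of_anchorAt_of_eulerDescent` concludes `QCDOf N_f`.  Q1/Q2/Q3 of the line and item 18328 are
not used. [folklore] -/
theorem chiralDescent_of_eulerDescent_of_wallNoGo_of_cornerPin :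
    ∀ (h16900 : Theses.EulerDescent.RayDescent) (h16902 : Theses.EulerDescent.ChiralCornerSoftness)
    (h16903 : Theses.EulerDescent.RetypedContinuumComplement)
    (hW : ∀ Nf : ℕ, (Nf = 2 ∨ Nf = 3) → ∀ reg : QCDRegularisation Nf, reg.HasMassScaling →
      (∀ c : ℝ, -1 < c → ∃ᶠ k in atTop, reg.mcrit k < c) → ∀ μ : ℝ,
      ¬ ∀ m : Fin Nf → ℝ, (∀ f, μ < m f) →
        ∃ (z shift : QCDField Nf → ℕ → ℝ) (T : OSData (QCDField Nf) 4),
          IsQCDAlong (reg.scheme m z shift) T ∧ T.IsNontrivial QCDField.glue ∧ T.IsNonGaussian QCDField.glue ∧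
            (∀ f g : Fin Nf, f ≠ g → T.IsNontrivial (QCDField.pseudoRe f g)) ∧
              ∃ Δ > 0, T.HasMassGap Δ ∧ (reg.scheme m z shift).HasLatticeMassGap Δ)
    (hPin : ∀ Nf : ℕ, (Nf = 2 ∨ Nf = 3) → ∀ reg : QCDRegularisation Nf, reg.HasMassScaling →
      (∃ c : ℝ, -1 < c ∧ ∀ᶠ k in atTop, c ≤ reg.mcrit k) → ∀ μ : ℝ,
      (∀ m : Fin Nf → ℝ, (∀ f, μ < m f) →
        ∃ (z shift : QCDField Nf → ℕ → ℝ) (T : OSData (QCDField Nf) 4),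
          IsQCDAlong (reg.scheme m z shift) T ∧ T.IsNontrivial QCDField.glue ∧ T.IsNonGaussian QCDField.glue ∧
            (∀ f g : Fin Nf, f ≠ g → T.IsNontrivial (QCDField.pseudoRe f g)) ∧
              ∃ Δ > 0, T.HasMassGap Δ ∧ (reg.scheme m z shift).HasLatticeMassGap Δ) →
      ∃ (mc : ℕ → ℝ) (μ₀ : ℝ),
        (∀ᶠ k in atTop, IsLUB {ν : ℝ | ¬ (∀ (R R' : ℕ) (A : QCDLatticeObservable Nf R)
          (B : QCDLatticeObservable Nf R'), ∃ (C δ : ℝ) (S₀ : ℕ), 0 < δ ∧ ∀ S : ℕ, S₀ ≤ S → ∀ n : ℕ, n ≤ S →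
            ‖qcdLatticeConnectedCorr (reg.β k) (2 * S + 1) (fun _ : Fin Nf => ν) A B n‖ ≤ C * Real.exp (-(δ * n)))}
          (mc k)) ∧
        Tendsto (fun k => (reg.mcrit k - mc k) * reg.Zm k / reg.a k) atTop (𝓝 μ₀)),
    Summit.QuantumFields.QCD.Theses.SpectralDefectExtinction.ChiralDescent := by
  intro h16900 h16902 h16903 hW hPin
  unfold Summit.QuantumFields.QCD.Theses.SpectralDefectExtinction.ChiralDescent
  rintro Nf hNf ⟨reg, hMS, M₁, -, hbody⟩
  by_cases hint : ∃ c : ℝ, -1 < c ∧ ∀ᶠ k in atTop, c ≤ reg.mcrit k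
  · obtain ⟨mc, μ₀, hcorner, hpin⟩ := hPin Nf hNf reg hMS hint M₁ hbody
    obtain ⟨reg₀, Mh, -, hcorner₀, hpin₀, hMS₀, hAS₀, hbranch₀, hMh, hheavy⟩ :=
      honestHeavyAnchorAt_of_threshold_of_cornerPin hNf reg hMS hint hbody hcorner hpin
    exact qcdOf_of_anchorAt_of_eulerDescent h16900 h16902 h16903 hNf reg₀ mc Mh hcorner₀ hpin₀ hMS₀ hAS₀ hbranch₀
      hMh hheavy
  · exfalso
    have hwall : ∀ c : ℝ, -1 < c → ∃ᶠ k in atTop, reg.mcrit k < c := by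
      intro c hc
      have hnev : ¬ ∀ᶠ k in atTop, c ≤ reg.mcrit k := fun hev => hint ⟨c, hc, hev⟩
      simpa only [Filter.not_eventually, not_le] using hnev
    exact hW Nf hNf reg hMS hwall M₁ hbody

end Summit.QuantumFields.QCD.Cruxes.ChiralDescent.GapUpsetRecut
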